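import Literature.NumberTheory.Rogawski1990.ArchCentralLimitChamberJetLimit      -- ★ p843566∕p843619 (this seat): the `_local` jet sockets (`of_chamberJetLimits_local`, `…JetBounds_local`), chambers
import Literature.NumberTheory.Automorphic.ArchLocalTorusOrbitalBlockSmooth       -- ★ (A1) p842196 (F0P3a-p05): `contDiffOn_integral_comp_conj_circleDiagonal_angles_of_blocks`
import Literature.NumberTheory.Rogawski1990.ArchCentralLimitChamberTransport    -- ★ p843105 (this seat): `injective_of_mem_chamber`
import HarnessLib

/-!
# The letter's `F_Θ∘chart = (ρ′Δ·Φ_Θ)(ζe^{iθ})` is `C^∞` on every chamber near the corner — the smoothness clause of the jet sockets, discharged from (A1)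
# (Rogawski 1990 §8.4 p. 126; Warner II Thm. 8.5.1.4 «`Φ_f` is `C^∞` on `J′(SI)`»)

Topic `NumberTheory/Rogawski1990`; namespace `Literature.NumberTheory.Rogawski1990`.  THEOREMS ONLY (no `def`, no instance, no notation, no axiom, no named fact, no `sorry`).
Cell `pub/hodgecm-mathlib`, ENGINE T1 (crux H413 = `stmt-HodgeConjecture-24833`); ROAD-Sd, N1 = `stub_ArchCentralLimitU21` (ROAD A, owner F0P3a-p05 (g13)); the N1 ASSEMBLY SKELETON (α1),
F0P3a-p02 (g12).  ★ `of_chamberJetLimits_local` ∕ `of_chamberJetBounds_local` ask per chamber for `∃ r > 0, ContDiffOn ℝ 3∕4 (F_Θ∘chart) (C_σ ∩ B(0,r))`; this file PAYS that clause once and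
for all, at `r = 1∕2`, to order `∞`: on `C_σ ∩ B(0,½)` the angles are pairwise distinct and closer than `1`, so the chart point is REGULAR (★ `injective_angleChart_of_injective`) and (A1) ★
`contDiffOn_integral_comp_conj_circleDiagonal_angles_of_blocks` (singleton blocks `b := id`) gives `C^∞` of the orbital factor; the Weyl factor `ρ′Δ(ζe^{iθ})` is globally smooth (entries
`ζ·e^{iθ_k} ≠ 0`).  HEAD **`contDiffOn_letterIntegrand_angleChart_chamber_ball`**.  After it the jet-bound socket owes exactly ONE thing per chamber: the fourth-jet BOUND (+ the value).
HONEST LABEL: HC_CM is proved only modulo the printed citations until rung 0 closes; bookkeeping, pays nothing by itself.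

## References
* [Rogawski1990] J. D. Rogawski, *Automorphic Representations of Unitary Groups in Three Variables* (1990), §8.4 pp. 126–127.
* [WarnerHASSLG2] G. Warner, *Harmonic Analysis on Semi-Simple Lie Groups II* (1972), §8.5.1 Thm. 8.5.1.4.
-/

set_option autoImplicit false

noncomputable section

open Filter Topology Set Function Metric MeasureTheory Measure NumberField NumberField.InfinitePlace
open scoped ContDiff

namespace Literature.NumberTheory.Rogawski1990

open Literature.NumberTheory.Automorphic Literature.NumberTheory.Automorphic.UnitaryGroup
open scoped Matrix MatrixGroups Matrix.Norms.Operator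

section Smooth

/-- The chart coordinate `θ ↦ ζ·e^{iθ_k}` (as a complex number) is smooth. [cite: Rogawski1990, §8.4 p. 126] -/
theorem contDiff_coe_angleChart_apply (ζ : Circle) (k : Fin 3) :
    ContDiff ℝ ∞ fun θ : Fin 3 → ℝ => (((ζ * Circle.exp (θ k) : Circle) : ℂ)) := by
  have h : (fun θ : Fin 3 → ℝ => (((ζ * Circle.exp (θ k) : Circle) : ℂ))) = fun θ : Fin 3 → ℝ => (ζ : ℂ) * Complex.exp ((θ k : ℂ) * Complex.I) := by
    funext θ
    rw [Circle.coe_mul, Circle.coe_exp]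
  rw [h]
  exact contDiff_const.mul (Complex.contDiff_exp.comp ((Complex.ofRealCLM.contDiff.comp (contDiff_apply ℝ ℝ k)).mul contDiff_const))

/-- The chart coordinate is never zero, so its inverse is smooth too. [cite: Rogawski1990, §8.4 p. 126] -/
theorem contDiff_coe_angleChart_apply_inv (ζ : Circle) (k : Fin 3) :
    ContDiff ℝ ∞ fun θ : Fin 3 → ℝ => (((ζ * Circle.exp (θ k) : Circle) : ℂ))⁻¹ :=
  (contDiff_coe_angleChart_apply ζ k).inv fun _ => Circle.coe_ne_zero _

/-- **The Weyl factor `ρ′Δ(ζe^{iθ})` is smooth in the angles** (the letter's exact tokens). [cite: Rogawski1990, §8.4 p. 126] -/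
theorem contDiff_rhoWeylDelta_angleChart_letterTokens (ζ : Circle) :
    ContDiff ℝ ∞ fun θ : Fin 3 → ℝ => ((((ζ * Circle.exp (θ 0) : Circle) : ℂ)) * (((ζ * Circle.exp (θ 2) : Circle) : ℂ))⁻¹) * ((1 - (((ζ * Circle.exp (θ 1) : Circle) : ℂ)) * (((ζ * Circle.exp (θ 0) : Circle) : ℂ))⁻¹) * (1 - (((ζ * Circle.exp (θ 2) : Circle) : ℂ)) * (((ζ * Circle.exp (θ 1) : Circle) : ℂ))⁻¹) * (1 - (((ζ * Circle.exp (θ 2) : Circle) : ℂ)) * (((ζ * Circle.exp (θ 0) : Circle) : ℂ))⁻¹)) := by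
  have h0 := contDiff_coe_angleChart_apply ζ 0
  have h1 := contDiff_coe_angleChart_apply ζ 1
  have h2 := contDiff_coe_angleChart_apply ζ 2
  have i0 := contDiff_coe_angleChart_apply_inv ζ 0
  have i1 := contDiff_coe_angleChart_apply_inv ζ 1
  have i2 := contDiff_coe_angleChart_apply_inv ζ 2
  exact (h0.mul i2).mul (((contDiff_const.sub (h1.mul i0)).mul (contDiff_const.sub (h2.mul i1))).mul (contDiff_const.sub (h2.mul i0)))

/-- On `C_σ ∩ B(0,½)` the chart point is REGULAR: pairwise distinct angles closer than `1` give pairwise distinct circle points (★ `injective_angleChart_of_injective`). [cite: Rogawski1990, §8.4 p. 126] -/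
theorem angleChart_ne_of_mem_chamber_ball (ζ : Circle) (σ : Equiv.Perm (Fin 3)) {θ : Fin 3 → ℝ}
    (hθ : θ ∈ {θ : Fin 3 → ℝ | θ (σ 0) < θ (σ 1) ∧ θ (σ 1) < θ (σ 2)} ∩ ball (0 : Fin 3 → ℝ) (1 / 2)) (i j : Fin 3) (hij : i ≠ j) :
    ζ * Circle.exp (θ i) ≠ ζ * Circle.exp (θ j) := by
  have hsmall : ∀ i j, |θ i - θ j| < 1 := by
    intro i j
    have hθb : dist θ 0 < 1 / 2 := hθ.2
    rw [dist_zero_right] at hθb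
    have hi : |θ i| < 1 / 2 := lt_of_le_of_lt (by simpa only [Real.norm_eq_abs] using norm_le_pi_norm θ i) hθb
    have hj : |θ j| < 1 / 2 := lt_of_le_of_lt (by simpa only [Real.norm_eq_abs] using norm_le_pi_norm θ j) hθb
    calc |θ i - θ j| ≤ |θ i| + |θ j| := abs_sub _ _
      _ < 1 / 2 + 1 / 2 := add_lt_add hi hj
      _ = 1 := by norm_num
  exact fun h => hij (injective_angleChart_of_injective (injective_of_mem_chamber hθ.1) hsmall h)

variable (L : Type) [Field L] (α : Fin 3 → L) (w : {w : InfinitePlace L // IsComplex w})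
  [MeasurableSpace (archLocal L 3 (Matrix.diagonal α) w)] [BorelSpace (archLocal L 3 (Matrix.diagonal α) w)]

/-- **THE ORBITAL FACTOR `Φ_Θ(ζe^{iθ})` IS `C^∞` ON EVERY CHAMBER NEAR THE CORNER** — (A1) ★ `contDiffOn_integral_comp_conj_circleDiagonal_angles_of_blocks` with singleton blocks, restricted to
`C_σ ∩ B(0,½)` (regular chart points). [cite: Rogawski1990, §8.4 p. 126] [cite: WarnerHASSLG2, §8.5.1 Thm. 8.5.1.4] -/
theorem contDiffOn_integral_comp_conj_angleChart_chamber_ball (hα : ∀ i, α i ≠ 0) (hreal : ∀ i, (w.1.embedding (α i)).im = 0)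
    (ν : Measure (archLocal L 3 (Matrix.diagonal α) w)) [IsFiniteMeasureOnCompacts ν]
    (Θ : Matrix (Fin 3) (Fin 3) ℂ → ℂ) (hΘ : ContDiff ℝ ∞ Θ)
    (hΘc : HasCompactSupport fun k : archLocal L 3 (Matrix.diagonal α) w => Θ ((k : GL (Fin 3) ℂ) : Matrix (Fin 3) (Fin 3) ℂ))
    (ζ : Circle) (σ : Equiv.Perm (Fin 3)) :
    ContDiffOn ℝ ∞ (fun θ : Fin 3 → ℝ => (∫ g, Θ (((g * ⟨circleDiagonal 3 (fun k => ζ * Circle.exp (θ k)), circleDiagonal_mem_archLocal_diagonal L 3 α w _⟩ * g⁻¹ : archLocal L 3 (Matrix.diagonal α) w) : GL (Fin 3) ℂ) : Matrix (Fin 3) (Fin 3) ℂ) ∂ν))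
      ({θ : Fin 3 → ℝ | θ (σ 0) < θ (σ 1) ∧ θ (σ 1) < θ (σ 2)} ∩ ball (0 : Fin 3 → ℝ) (1 / 2)) := by
  have h := contDiffOn_integral_comp_conj_circleDiagonal_angles_of_blocks L 3 α w hα hreal (b := fun i : Fin 3 => i)
    (fun i j hij hb => absurd hb hij) ν Θ hΘ hΘc (fun _ : Fin 3 => ζ)
  refine h.mono ?_
  intro θ hθ i j hij
  exact angleChart_ne_of_mem_chamber_ball ζ σ hθ i j hij

/-- **THE LETTER'S `F_Θ∘chart = (ρ′Δ·Φ_Θ)(ζe^{iθ})` IS `C^∞` ON EVERY CHAMBER NEAR THE CORNER** — the smoothness clause of ★ `of_chamberJetLimits_local` (order 3) and ★ `of_chamberJetBounds_local`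
(order 4) for the letter's torus function, PAID with `r = ½` to order `∞` (`.of_le`). [cite: Rogawski1990, §8.4 p. 126] [cite: WarnerHASSLG2, §8.5.1 Thm. 8.5.1.4] -/
theorem contDiffOn_letterIntegrand_angleChart_chamber_ball (hα : ∀ i, α i ≠ 0) (hreal : ∀ i, (w.1.embedding (α i)).im = 0)
    (ν : Measure (archLocal L 3 (Matrix.diagonal α) w)) [IsFiniteMeasureOnCompacts ν]
    (Θ : Matrix (Fin 3) (Fin 3) ℂ → ℂ) (hΘ : ContDiff ℝ ∞ Θ)
    (hΘc : HasCompactSupport fun k : archLocal L 3 (Matrix.diagonal α) w => Θ ((k : GL (Fin 3) ℂ) : Matrix (Fin 3) (Fin 3) ℂ))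
    (ζ : Circle) (σ : Equiv.Perm (Fin 3)) :
    ContDiffOn ℝ ∞ (fun θ : Fin 3 → ℝ => ((((ζ * Circle.exp (θ 0) : Circle) : ℂ)) * (((ζ * Circle.exp (θ 2) : Circle) : ℂ))⁻¹) * ((1 - (((ζ * Circle.exp (θ 1) : Circle) : ℂ)) * (((ζ * Circle.exp (θ 0) : Circle) : ℂ))⁻¹) * (1 - (((ζ * Circle.exp (θ 2) : Circle) : ℂ)) * (((ζ * Circle.exp (θ 1) : Circle) : ℂ))⁻¹) * (1 - (((ζ * Circle.exp (θ 2) : Circle) : ℂ)) * (((ζ * Circle.exp (θ 0) : Circle) : ℂ))⁻¹)) * (∫ g, Θ (((g * ⟨circleDiagonal 3 (fun k => ζ * Circle.exp (θ k)), circleDiagonal_mem_archLocal_diagonal L 3 α w _⟩ * g⁻¹ : archLocal L 3 (Matrix.diagonal α) w) : GL (Fin 3) ℂ) : Matrix (Fin 3) (Fin 3) ℂ) ∂ν))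
      ({θ : Fin 3 → ℝ | θ (σ 0) < θ (σ 1) ∧ θ (σ 1) < θ (σ 2)} ∩ ball (0 : Fin 3 → ℝ) (1 / 2)) :=
  (contDiff_rhoWeylDelta_angleChart_letterTokens ζ).contDiffOn.mul (contDiffOn_integral_comp_conj_angleChart_chamber_ball L α w hα hreal ν Θ hΘ hΘc ζ σ)

/-- The same, packaged as the socket clause `∃ r > 0, ContDiffOn ℝ n (F_Θ∘chart) (C_σ ∩ B(0,r))` for any finite order `n` (e.g. `3` or `4`). [cite: Rogawski1990, §8.4 p. 126] -/
theorem exists_contDiffOn_letterIntegrand_angleChart_chamber_ball (hα : ∀ i, α i ≠ 0) (hreal : ∀ i, (w.1.embedding (α i)).im = 0)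
    (ν : Measure (archLocal L 3 (Matrix.diagonal α) w)) [IsFiniteMeasureOnCompacts ν]
    (Θ : Matrix (Fin 3) (Fin 3) ℂ → ℂ) (hΘ : ContDiff ℝ ∞ Θ)
    (hΘc : HasCompactSupport fun k : archLocal L 3 (Matrix.diagonal α) w => Θ ((k : GL (Fin 3) ℂ) : Matrix (Fin 3) (Fin 3) ℂ))
    (ζ : Circle) (σ : Equiv.Perm (Fin 3)) (n : ℕ) :
    ∃ r : ℝ, 0 < r ∧ ContDiffOn ℝ n (fun θ : Fin 3 → ℝ => ((((ζ * Circle.exp (θ 0) : Circle) : ℂ)) * (((ζ * Circle.exp (θ 2) : Circle) : ℂ))⁻¹) * ((1 - (((ζ * Circle.exp (θ 1) : Circle) : ℂ)) * (((ζ * Circle.exp (θ 0) : Circle) : ℂ))⁻¹) * (1 - (((ζ * Circle.exp (θ 2) : Circle) : ℂ)) * (((ζ * Circle.exp (θ 1) : Circle) : ℂ))⁻¹) * (1 - (((ζ * Circle.exp (θ 2) : Circle) : ℂ)) * (((ζ * Circle.exp (θ 0) : Circle) : ℂ))⁻¹)) * (∫ g, Θ (((g * ⟨circleDiagonal 3 (fun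 k => ζ * Circle.exp (θ k)), circleDiagonal_mem_archLocal_diagonal L 3 α w _⟩ * g⁻¹ : archLocal L 3 (Matrix.diagonal α) w) : GL (Fin 3) ℂ) : Matrix (Fin 3) (Fin 3) ℂ) ∂ν))
      ({θ : Fin 3 → ℝ | θ (σ 0) < θ (σ 1) ∧ θ (σ 1) < θ (σ 2)} ∩ ball (0 : Fin 3 → ℝ) r) :=
  ⟨1 / 2, by norm_num, (contDiffOn_letterIntegrand_angleChart_chamber_ball L α w hα hreal ν Θ hΘ hΘc ζ σ).of_le (by exact_mod_cast le_top)⟩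

end Smooth

end Literature.NumberTheory.Rogawski1990

end
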